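import Literature.NumberTheory.EllipticCurves.ModPIrreducibleCongruenceTransferProofs
import Literature.NumberTheory.EllipticCurves.TorsionGaloisRepMatrixProofs
import Literature.NumberTheory.EllipticCurves.OrdinaryPrimesProofs
import Mathlib.LinearAlgebra.Trace
import Mathlib.LinearAlgebra.Determinant
import HarnessLib

/-!
# Frobenius supply under a surjective mod-`p` representation: good primes `ℓ` with PRESCRIBED
# `a_ℓ(E) mod p` and `ℓ mod p` (Chebotarev in `ℚ(E[p])`, Serre's (238), DDT 2.8 (a)) — proofs only

Topic `Literature/NumberTheory/EllipticCurves`; namespace `Literature.NumberTheory.EllipticCurves`.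
THEOREMS ONLY (no definition, no named fact).

For an elliptic curve `E = W/ℚ` in global minimal form with `ρ̄_{E,p} : Γ_ℚ → Aut(E[p]) ≅ GL₂(𝔽_p)`
SURJECTIVE, every pair `(t, d) ∈ 𝔽_p × 𝔽_p^×` is `(tr, det)` of some `ρ̄(σ)` (the companion matrix
`(0, -d; 1, t)` has trace `t` and determinant `d`); by the Chebotarev density
theorem for the division field `ℚ(E[p])` — a THEOREM of the tree, `chebotarev_geomTorsion_holds`
(`TorsionFrobeniusChebotarevProofs`; Tate, *GCFT* §2.4) — `σ` acts on `E[p]` as an arithmetic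
Frobenius `φ` above a prime `ℓ` outside any finite set; and `tr ρ̄(φ) = a_ℓ (mod p)`
(`WeierstrassCurve.trace_galoisRepTorsion_frobenius_eq`, Serre 1981 (238)), `det ρ̄(φ) = ℓ (mod p)`
(`WeierstrassCurve.det_galoisRepTorsion_frobenius_eq`, Darmon–Diamond–Taylor 2.8 (a)).  Hence:

* `toMatrix_galoisRepTorsionLinear_eq_rhoMat`, `trace_galoisRepTorsionLinear_eq_trace_rhoMat`,
  `det_galoisRepTorsionLinear_eq_det_rhoMat` — the `𝔽_p`-linear map `ρ̄(σ)` on `E[p]` has matrix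
  `rhoMat W e σ` in the basis of a frame `e : E[p] ≃ (ℤ/p)²` (`DokchitserDokchitser2012.rhoMat`), hence
  its trace / determinant (linear algebra only);
* **`exists_goodPrime_frobeniusTrace_det_eq_of_hasSurjectiveModNGaloisRep`** — `ρ̄_{E,p}` onto,
  `t : ZMod p`, `d : ZMod p` with `d ≠ 0`, `S` a finite set of naturals ⟹ there is a prime `ℓ ∉ S`,
  `ℓ ≠ p`, `ℓ ∤ Δ_min(W)` (so `W` has good reduction at `ℓ`, `hasGoodReductionAtPrime_of_not_dvd`),
  with `(a_ℓ(W) : ZMod p) = t` and `(ℓ : ZMod p) = d`;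
* `exists_goodPrime_mod_three_eq_two_not_dvd_frobeniusTrace_of_surj` — at `p = 3`: a prime
  `ℓ ∉ S`, `ℓ ≠ 3`, `ℓ ∤ Δ_min(W)`, with `ℓ ≡ 2 (mod 3)` and `3 ∤ a_ℓ(W)` (the auxiliary prime of the
  Deligne–Serre descent `DeligneSerreCompanionAuxiliaryPrimeDescentProofs` at `p = 3`).

## References

* J. Tate, *Global class field theory*, Ch. VII of Cassels–Fröhlich (1967), §2.4. [TateGCFT1967]
* J.-P. Serre, *Quelques applications du théorème de densité de Chebotarev*, Publ. Math. IHÉS 54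
  (1981), §8.1 eq. (238). [Serre1981]
* H. Darmon, F. Diamond, R. Taylor, *Fermat's Last Theorem* (1995), Prop. 2.8 (a). [DarmonDiamondTaylor1995]
* J. H. Silverman, *The Arithmetic of Elliptic Curves*, 2nd ed. (2009), III.7. [SilvermanAEC2009]
-/

noncomputable section

open scoped Classical
open NumberField IsDedekindDomain Field WeierstrassCurve Matrix

namespace Literature.NumberTheory.EllipticCurves

open Literature.NumberTheory.EllipticCurves.DokchitserDokchitser2012
  Literature.NumberTheory.GaloisRepresentations Rat.HeightOneSpectrum

variable (W : WeierstrassCurve ℚ)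

/-! ### §1 The `𝔽_p`-linear map `ρ̄(σ)` and its matrix in a frame -/

section Frame

variable {p : ℕ} [NeZero p] (e : geomTorsion W p ≃+ (Fin 2 → ZMod p))

/-- **The matrix of `ρ̄(σ)` in the basis of a linear frame `e'` agreeing with `e` is `rhoMat W e σ`.**
[cite: SilvermanAEC2009, III.7 (Aut(E[m]) ≅ GL₂(ℤ/mℤ))] -/
theorem toMatrix_galoisRepTorsionLinear_eq_rhoMat
    (e' : letI : Module (ZMod p) (geomTorsion W p) := AddSubgroup.torsionBy.zmodModule
      geomTorsion W p ≃ₗ[ZMod p] (Fin 2 → ZMod p))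
    (he : ∀ x, e' x = e x) (σ : absoluteGaloisGroup ℚ) :
    letI : Module (ZMod p) (geomTorsion W p) := AddSubgroup.torsionBy.zmodModule
    LinearMap.toMatrix (Module.Basis.ofEquivFun e') (Module.Basis.ofEquivFun e')
        ((galoisRepTorsion W p σ).toAdd.toAddMonoidHom.toZModLinearMap p) = rhoMat W e σ := by
  letI : Module (ZMod p) (geomTorsion W p) := AddSubgroup.torsionBy.zmodModule
  have he' : ∀ y, e'.symm y = e.symm y := fun y ↦ by
    apply e'.injective
    rw [LinearEquiv.apply_symm_apply, he, AddEquiv.apply_symm_apply]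
  ext i j
  rw [LinearMap.toMatrix_apply, Module.Basis.coe_ofEquivFun, Module.Basis.ofEquivFun_repr_apply,
    rhoMat_apply, repMatrix_apply, he]
  simp only [he']
  rfl

/-- **`tr ρ̄(σ) = tr (rhoMat W e σ)`** on the `𝔽_p`-plane `E[p]`. [cite: SilvermanAEC2009, III.7 (Aut(E[m]) ≅ GL₂(ℤ/mℤ))] -/
theorem trace_galoisRepTorsionLinear_eq_trace_rhoMat (σ : absoluteGaloisGroup ℚ) :
    letI : Module (ZMod p) (geomTorsion W p) := AddSubgroup.torsionBy.zmodModule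
    LinearMap.trace (ZMod p) (geomTorsion W p)
        ((galoisRepTorsion W p σ).toAdd.toAddMonoidHom.toZModLinearMap p) = (rhoMat W e σ).trace := by
  letI : Module (ZMod p) (geomTorsion W p) := AddSubgroup.torsionBy.zmodModule
  let e' : geomTorsion W p ≃ₗ[ZMod p] (Fin 2 → ZMod p) :=
    { (e : geomTorsion W p →+ (Fin 2 → ZMod p)).toZModLinearMap p with
      invFun := e.symm
      left_inv := e.left_inv
      right_inv := e.right_inv }
  rw [LinearMap.trace_eq_matrix_trace (ZMod p) (Module.Basis.ofEquivFun e'),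
    toMatrix_galoisRepTorsionLinear_eq_rhoMat W e e' (fun _ ↦ rfl)]

/-- **`det ρ̄(σ) = det (rhoMat W e σ)`** on the `𝔽_p`-plane `E[p]`. [cite: SilvermanAEC2009, III.7 (Aut(E[m]) ≅ GL₂(ℤ/mℤ))] -/
theorem det_galoisRepTorsionLinear_eq_det_rhoMat (σ : absoluteGaloisGroup ℚ) :
    letI : Module (ZMod p) (geomTorsion W p) := AddSubgroup.torsionBy.zmodModule
    LinearMap.det ((galoisRepTorsion W p σ).toAdd.toAddMonoidHom.toZModLinearMap p) =
      (rhoMat W e σ).det := by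
  letI : Module (ZMod p) (geomTorsion W p) := AddSubgroup.torsionBy.zmodModule
  let e' : geomTorsion W p ≃ₗ[ZMod p] (Fin 2 → ZMod p) :=
    { (e : geomTorsion W p →+ (Fin 2 → ZMod p)).toZModLinearMap p with
      invFun := e.symm
      left_inv := e.left_inv
      right_inv := e.right_inv }
  rw [← LinearMap.det_toMatrix (Module.Basis.ofEquivFun e'),
    toMatrix_galoisRepTorsionLinear_eq_rhoMat W e e' (fun _ ↦ rfl)]

end Frame

/-! ### §2 Good primes with prescribed `(a_ℓ mod p, ℓ mod p)` under surjectivity -/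

variable [W.IsElliptic] [W.IsGloballyMinimal]

/-- **Frobenius supply under a surjective mod-`p` representation.**  Let `E = W/ℚ` be an elliptic
curve in global minimal form, `p` a prime with `ρ̄_{E,p}` onto `Aut(E[p])`, `t ∈ 𝔽_p`, `d ∈ 𝔽_p^×` and
`S` a finite set of naturals.  Then there is a prime `ℓ ∉ S`, `ℓ ≠ p`, `ℓ ∤ Δ_min(W)` (so of good
reduction), with `a_ℓ(W) ≡ t` and `ℓ ≡ d (mod p)`.  Proof: the companion matrix `g = (0, −d; 1, t)` (trace `t`,
determinant `d ≠ 0`) is `rhoMat W e σ` for some `σ ∈ Γ_ℚ`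
(`hasSurjectiveModNGaloisRep_iff_matrix`); by Chebotarev for `ℚ(E[p])` (`chebotarev_geomTorsion_holds`)
`σ` acts on `E[p]` as an arithmetic Frobenius `φ` above a prime `ℓ ∉ S ∪ {p} ∪ {q ∣ Δ_min}`; then
`ρ̄(φ) = ρ̄(σ)`, and `tr ρ̄(φ) = a_ℓ`, `det ρ̄(φ) = ℓ (mod p)` (Serre (238); DDT 2.8 (a)).
[cite: TateGCFT1967, §2.4 (Tchebotarev density theorem)] [cite: Serre1981, §8.1 eq. (238) (p. 188)]
[cite: DarmonDiamondTaylor1995, Prop. 2.8 (a)] -/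
theorem exists_goodPrime_frobeniusTrace_det_eq_of_hasSurjectiveModNGaloisRep (p : ℕ) [Fact p.Prime]
    (hsurj : W.HasSurjectiveModNGaloisRep p) (t d : ZMod p) (hd : d ≠ 0) (S : Set ℕ) (hS : S.Finite) :
    ∃ ℓ : ℕ, ℓ.Prime ∧ ℓ ∉ S ∧ ℓ ≠ p ∧ ¬ (ℓ : ℤ) ∣ minimalDiscriminantInt W ∧
      ((W.frobeniusTrace ℓ : ℤ) : ZMod p) = t ∧ ((ℓ : ℕ) : ZMod p) = d := by
  classical
  have hp : p.Prime := Fact.out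
  haveI : NeZero p := ⟨hp.ne_zero⟩
  letI : Module (ZMod p) (geomTorsion W p) := AddSubgroup.torsionBy.zmodModule
  -- a frame `E[p] ≃ (ℤ/p)²`
  obtain ⟨e⟩ := nonempty_geomTorsion_addEquiv_fin_two W (m := p)
    (by exact_mod_cast hp.ne_zero : ((p : ℕ) : ℚ) ≠ 0)
  -- the companion matrix `(0, -d; 1, t)`: trace `t`, determinant `d`
  let g : Matrix (Fin 2) (Fin 2) (ZMod p) := !![0, -d; 1, t]
  have hgdet : g.det = d := by simp [g, Matrix.det_fin_two]
  have hgtr : g.trace = t := by simp [g, Matrix.trace_fin_two]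
  have hginv : ∃ d' : ZMod p, g.det * d' = 1 := ⟨d⁻¹, by rw [hgdet, mul_inv_cancel₀ hd]⟩
  obtain ⟨σ, hσ⟩ := (hasSurjectiveModNGaloisRep_iff_matrix W e).mp hsurj g hginv
  -- Chebotarev in `ℚ(E[p])`, outside `S ∪ {p} ∪ {q ∣ Δ_min}`
  have hΔ0 : minimalDiscriminantInt W ≠ 0 := minimalDiscriminantInt_ne_zero W
  let S' : Set ℕ := S ∪ {q | q = p ∨ (q : ℤ) ∣ minimalDiscriminantInt W}
  have hS' : S'.Finite := by
    refine hS.union ((Set.finite_le_nat (max p (minimalDiscriminantInt W).natAbs)).subset ?_)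
    rintro q (rfl | hq)
    · exact Set.mem_setOf.mpr (le_max_left _ _)
    · exact Set.mem_setOf.mpr (le_max_of_le_right
        (Nat.le_of_dvd (Int.natAbs_pos.mpr hΔ0) (Int.natCast_dvd.mp hq)))
  obtain ⟨ℓ, v, 𝔓, φ, hℓ, hℓS', hℓv, h𝔓, hφ, hact⟩ :=
    chebotarev_geomTorsion_holds W (p : ℤ) (by exact_mod_cast hp.ne_zero) S' hS' σ
  haveI : Fact ℓ.Prime := ⟨hℓ⟩
  have hℓS : ℓ ∉ S := fun h ↦ hℓS' (Or.inl h)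
  have hℓp : ℓ ≠ p := fun h ↦ hℓS' (Or.inr (Or.inl h))
  have hℓΔ : ¬ (ℓ : ℤ) ∣ minimalDiscriminantInt W := fun h ↦ hℓS' (Or.inr (Or.inr h))
  have hgood : W.HasGoodReductionAtPrime ℓ := hasGoodReductionAtPrime_of_not_dvd W ℓ hℓΔ
  have hv : (primesEquiv v : ℕ) = ℓ := primesEquiv_eq_of_natCast_mem hℓ hℓv
  -- `ρ̄(φ) = ρ̄(σ)` on `E[p]`
  have hφσ : galoisRepTorsion W p φ = galoisRepTorsion W p σ := by
    apply Multiplicative.toAdd.injective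
    ext P
    simp only [galoisRepTorsion_apply, hact P]
  -- traces and determinants: Serre (238), DDT 2.8 (a), read in the frame
  have htr := W.trace_galoisRepTorsion_frobenius_eq p hℓp hgood hv h𝔓 hφ
  have hdet := W.det_galoisRepTorsion_frobenius_eq p hℓp hgood hv h𝔓 hφ
  rw [hφσ, trace_galoisRepTorsionLinear_eq_trace_rhoMat W e σ, hσ, hgtr] at htr
  rw [hφσ, det_galoisRepTorsionLinear_eq_det_rhoMat W e σ, hσ, hgdet] at hdet
  exact ⟨ℓ, hℓ, hℓS, hℓp, hℓΔ, htr.symm, hdet.symm⟩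

/-- **At `p = 3`: under `ρ̄_{E,3}` onto there is a good prime `ℓ ≡ 2 (mod 3)` with `3 ∤ a_ℓ(E)`,
outside any finite set** — the auxiliary prime of the Deligne–Serre descent at `3`
(`DeligneSerreCompanionAuxiliaryPrimeDescentProofs.exists_isNewform0_dvd_level_congr_weight_add_two_three_of_auxPrime`):
`(tr, det) = (1, −1)` is realised in `GL₂(𝔽₃)`. [cite: TateGCFT1967, §2.4 (Tchebotarev density theorem)]
[cite: Serre1981, §8.1 eq. (238) (p. 188)] [cite: DarmonDiamondTaylor1995, Prop. 2.8 (a)] -/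
theorem exists_goodPrime_mod_three_eq_two_not_dvd_frobeniusTrace_of_surj [Fact (3 : ℕ).Prime]
    (hsurj : W.HasSurjectiveModNGaloisRep 3) (S : Set ℕ) (hS : S.Finite) :
    ∃ ℓ : ℕ, ℓ.Prime ∧ ℓ ∉ S ∧ ℓ ≠ 3 ∧ ¬ (ℓ : ℤ) ∣ minimalDiscriminantInt W ∧ ℓ % 3 = 2 ∧
      ¬ (3 : ℤ) ∣ W.frobeniusTrace ℓ := by
  have h2 : (-1 : ZMod 3) ≠ 0 := neg_ne_zero.mpr one_ne_zero
  obtain ⟨ℓ, hℓ, hℓS, hℓ3, hℓΔ, htr, hdet⟩ :=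
    exists_goodPrime_frobeniusTrace_det_eq_of_hasSurjectiveModNGaloisRep W 3 hsurj 1 (-1) h2 S hS
  refine ⟨ℓ, hℓ, hℓS, hℓ3, hℓΔ, ?_, fun h3 ↦ ?_⟩
  · -- `ℓ ≡ -1 (mod 3)`, i.e. `3 ∣ ℓ + 1`
    have h : (((ℓ + 1 : ℕ) : ℤ) : ZMod 3) = 0 := by
      push_cast
      rw [hdet, neg_add_cancel]
    have h' := (ZMod.intCast_zmod_eq_zero_iff_dvd _ 3).mp h
    omega
  · rw [(ZMod.intCast_zmod_eq_zero_iff_dvd _ 3).mpr h3] at htr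
    exact zero_ne_one htr

end Literature.NumberTheory.EllipticCurves

end
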